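import Summits.QuantumFields.BalabanUV.T4Continuum.Support.NE4ReadOutSocketMarginalRecipe

/-!
# NE9MarginalFreeClass — leaf MP of the NE9 skeleton AT THE ABSTRACT READ-OUT LEVEL: the projection binder
# `ProjInto Adm MF (margProj r A)` follows from ONE NORMALISATION IDENTITY («the read-out reads the coefficient on the
# marginal ray»: `r_j(c·A↾j) = c·r_j(A↾j)`, `r_j(A↾j) = 1`) plus additivity on the pair (family, ray); for PROBE RECIPES
# (node U2's `T4BetaReadOutLipschitz.Probes.recipe`) additivity and homogeneity are KERNEL, so MP ⇐ the one displayed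
# number per read step `Pr.recipe k A = 1` and a displayed structural class `S` containing the projections
# (cell `pub-balaban`, T⁴ fan-out, `HOME/BINDER-OWNERS.md` row NE9; NE9 formalisation swarm, unit
# `b2b-balaban-t4-ne9-formalise-leaf-04-g3`; LEAN PLACEMENT RULE 2026-08-19: our bookkeeping lives under `Summits/`)

HONEST FRAMING (T4-DAG PAGE 1).  The cell's T⁴ target is rung (B)+1 — existence AND uniqueness of the ε → 0 limit of
gauge-invariant expectations on a FIXED finite torus T⁴; NOT infinite volume, NOT a mass gap, NOT the Clay problem.  The spine
estimate NE9 (`T4OutputRate.NE9`) is NOT PRINTED in the audited series and NOT PROVED anywhere in the tree («NE9 ⇐ the named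
binders»).  This module is `[folklore]` linear-algebra bookkeeping over the ABSTRACT carriers and read-outs of the frame; nothing
of [I] = [Balaban1987RG1] is asserted — the locators say only which printed sentence a hypothesis SHAPE types (ABSOLUTE RULE).
No `def`; no `def … : Prop`; no END face re-wired; nothing instantiated on Bałaban's objects (0/18 leaves instantiated; spine
estimates PROVED 0/9 — both unchanged).  HONEST DEPENDENCY (cell, verbatim): continuum YM on T⁴ ⇐ BetaPertH ∧ nine spine
estimates (0/9 proved); BetaPertH ⇐ (D1) ∧ (D4) ∧ CAP+tail; G-an2-4 gates asym, D1 and NE2/3/4.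

CONTEXT.  The row owner's v1.3 dictionary (`Support/NE9MarginalProjection`, skeleton `t4/b2b-balaban-t4-ne9-p1/SKELETON-NE9-P1.md`
v1.3.3 §3 rows RO/AW/MP) feeds the history channel the PROJECTED old terms `margProj r A H = H − Σ_j r_j(H↾j)·A` and displays
four projection binders on the END faces `NE9MarginalProjectionEnd.…_compProj` / `…_margProj` (and on node U2's sockets
`NE4ReadOutSocketMarginal(Recipe)`): `ProjAdditive`, `ProjScaleComm`, `ProjSize` — THEOREMS for `margProj r A` from the
read-out's additivity/zero/size (`projAdditive_margProj`, `projScaleComm_margProj`, `projSize_margProj`; for probe recipes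
`NE4ReadOutSocketMarginalRecipe.projBinders_recipe`) — and `ProjInto Adm MF (margProj r A)` («the projected families are
marginal-free»), so far DISPLAYED everywhere («r is normalised by r_j(A_□-family) = 1 and linear, MF = ker r ∩ Adm-span —
STRUCTURE / [dict]», skeleton row MP; «WHAT STAYS OPEN after this (no row owns it): … row NE9's `ProjInto` (normalisation of
the recipe against the marginal direction `A`)», `NE4ReadOutSocketMarginalRecipe` header).

WHAT IS PROVED (kernel; imports BY NAME; 0 `def`, 0 `sorry`, no new axiom).
§1 ONE SCALE.  `restrictScale_margProj(')`: the scale-j slice of `margProj r A H` is `(H − c_j·A)↾j`, `c_j = r_j(H↾j)`.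
   `read_restrictScale_margProj_eq`: under additivity on the pair and homogeneity on the ray, `r_j((margProj r A H)↾j) =
   c_j·(1 − r_j(A↾j))` — hence ZERO under the normalisation `r_j(A↾j) = 1` (or when `c_j = 0`), `…_eq_zero`, and NON-ZERO when
   `r_j(A↾j) ≠ 1` and `c_j ≠ 0`, `read_restrictScale_margProj_ne_zero`: the normalisation is load-bearing, not decorative.
§2 THE BINDER.  `projInto_margProj`: `ProjInto Adm {H | H ∈ S ∧ ∀ j, r j (restrictScale j H) = 0} (margProj r A)` — the
   marginal-free class written INLINE as «structural class `S` ∩ ker r» — from (i) `hS` the projections lie in `S` (displayed: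
   with O1, «analytic minus a multiple of the one-cube Wilson action is analytic»), (ii) additivity of `r_j` on the pairs
   `(H, c·A)`, (iii) homogeneity on the ray, (iv) per scale: normalisation `r_j(A↾j) = 1` OR `r_j` vanishes on `Adm` (the scale-0
   escape: nothing is created or read at scale 0, (0.23) p. 256).  Corollary `…_of_readAdditive` from the frame's own
   `ReadAdditive Adm r` when the ray `ℝ·A ⊆ Adm`.  `projInto_margProj_shiftRead`: the same for `shiftRead r₀` (node U2's
   indexing: `r (k+1) := r₀ k`, `r 0 := 0`) from the three identities AT THE READ STEPS only.  Dictionary sanity: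
   `margProj_eq_self_of_read_eq_zero` (on marginal-free inputs the projection is the identity — `𝒯 ∘ P` agrees with `𝒯`
   there) and `margProj_idem` (P ∘ P = P under the §1 hypotheses).
§3 PROBE RECIPES (node U2's `Probes`, chart radius `α > 0`).  `cplx_smul`, `mixedDeriv_const_mul` (an analytic chart function
   times a constant), `recipe_smul` (the recipe is HOMOGENEOUS on analytic slices — companion of p209911's `recipe_sub`),
   `smul_mem_analytic`, `margProj_mem_analytic` (the projection of an analytic slice along an analytic direction is analytic,
   for ANY read-out), and **`projInto_recipe`**: `ProjInto Adm {H | H ∈ Pr.Analytic α ∧ H ∈ S ∧ ∀ k, Pr.recipe k H = 0}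
   (margProj (shiftRead Pr.recipe) A)` from `Adm ⊆ Pr.Analytic α`, `A ∈ Pr.Analytic α`, `hS`, and the ONE displayed number per
   read step `hnorm : ∀ k, Pr.recipe k A = 1` — with `projBinders_recipe` ALL FOUR projection binders of the marginal-projection
   END faces are kernel for probe recipes modulo that normalisation and the class `S` (both DATA of the instantiation layer O1).
§4 SANITY.  The owner's toy `NE9MarginalProjectionEnd.toy_projInto` RE-DERIVED from §2 (`example`).

READING (census-class; no landed theorem affected).  Row MP's O1-content is exactly: (a) the probe DATUM reads 1 on the
marginal direction — [I] p. 258 «They allow the extraction of terms, which grouped together yield an expansion of βA^η(exp iη𝐇).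
… We define the function β_j(g_{j−1}) to be equal to the coefficient β» and the recipe (1.20)–(1.22) p. 264 (TYPE: β IS the
coefficient of A^η, i.e. the recipe applied to A^η returns 1); (b) a structural class `S` (analytic, gauge-invariant, vacuum-
subtracted, …) stable under the projection, on which the channel's size binder S5-MF is then to be proved (O-NE9-2, GATED on
O1).  Neither (a) nor (b) is asserted here.

References (TYPES/STRUCTURE only): [Balaban1987RG1] CMP 109 (1987) (0.23) p. 256, (0.28)–(0.29) p. 258, (1.3) p. 260,
(1.17)–(1.18) p. 263, (1.20)–(1.22) p. 264, (4.3)–(4.4) p. 281.  Provenance: NE9 swarm leaf-04 gen 3, 2026-08-20.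
-/

noncomputable section

namespace Summit.QuantumFields.BalabanUV.T4Continuum.NE9MarginalFreeClass

open scoped BigOperators
open Metric
open Literature.MathematicalPhysics.QuantumFieldTheory.Balaban1983to89
open Literature.MathematicalPhysics.QuantumFieldTheory.Balaban1983to89.T4OutputRate
open T4BetaReadOut (Slice ReadOut)
open T4BetaReadOutLipschitz (Probes)
open B12Decay510 (mixedDeriv)
open T4HistoryLipschitzRecursion (restrictScale restrictScale_of_eq restrictScale_of_ne)
open NE9MarginalProjection (margProj shiftRead ReadAdditive ProjInto)
open NE4ReadOutSocketMarginalRecipe (cplx_sub recipe_sub recipe_restrictScale restrictScale_mem_analytic)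

variable {C : Carriers} {Bg : Type}

/-! ## §1 One scale: the read-out of the projected slice -/

/-- The scale-j slice of the projected family is the scale-j slice of `H − c_j·A` with the ONE coefficient `c_j = r_j(H↾j)`
((1.3) p. 260 of [I]: one counterterm `−β_{j+1}(g_j)A` per creation step). [cite: Balaban1987RG1, (1.3) p.260] -/
theorem restrictScale_margProj' (r : ℕ → (Bg → C.Dom → ℝ) → ℝ) (A H : Bg → C.Dom → ℝ) (j : ℕ) :
    restrictScale j (margProj r A H) = restrictScale j (H - r j (restrictScale j H) • A) := by
  funext U X
  by_cases hX : C.scale X = j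
  · rw [restrictScale_of_eq _ hX, restrictScale_of_eq _ hX]
    simp only [margProj, Pi.sub_apply, Pi.smul_apply, smul_eq_mul, hX]
  · rw [restrictScale_of_ne _ hX, restrictScale_of_ne _ hX]

/-- Slice form: `(margProj r A H)↾j = H↾j − c_j·(A↾j)`, `c_j = r_j(H↾j)`. [folklore] -/
theorem restrictScale_margProj (r : ℕ → (Bg → C.Dom → ℝ) → ℝ) (A H : Bg → C.Dom → ℝ) (j : ℕ) :
    restrictScale j (margProj r A H) = restrictScale j H - r j (restrictScale j H) • restrictScale j A := by
  funext U X
  by_cases hX : C.scale X = j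
  · simp only [Pi.sub_apply, Pi.smul_apply, smul_eq_mul, restrictScale_of_eq _ hX, margProj, hX]
  · simp only [Pi.sub_apply, Pi.smul_apply, smul_eq_mul, restrictScale_of_ne _ hX, mul_zero, sub_zero]

/-- **THE READ-OUT OF THE PROJECTED SLICE.**  If `r_j` is additive on the pair `(H, c·A)` and homogeneous on the ray `ℝ·A`,
then `r_j((margProj r A H)↾j) = r_j(H↾j)·(1 − r_j(A↾j))`. [folklore] -/
theorem read_restrictScale_margProj_eq {r : ℕ → (Bg → C.Dom → ℝ) → ℝ} {A H : Bg → C.Dom → ℝ} {j : ℕ}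
    (hsub : ∀ c : ℝ, r j (restrictScale j (H - c • A)) = r j (restrictScale j H) - r j (restrictScale j (c • A)))
    (hcoef : ∀ c : ℝ, r j (restrictScale j (c • A)) = c * r j (restrictScale j A)) :
    r j (restrictScale j (margProj r A H)) = r j (restrictScale j H) * (1 - r j (restrictScale j A)) := by
  rw [restrictScale_margProj', hsub, hcoef]
  ring

/-- **MARGINAL-FREE UNDER THE NORMALISATION.**  With, in addition, `r_j(A↾j) = 1` («β is the coefficient of A^η», [I]
p. 258 / (1.20)–(1.22) p. 264 — TYPE) or `r_j(H↾j) = 0`, the projected slice has ZERO read-out.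
[cite: Balaban1987RG1, (0.28) p.258 and (1.20)-(1.22) p.264] -/
theorem read_restrictScale_margProj_eq_zero {r : ℕ → (Bg → C.Dom → ℝ) → ℝ} {A H : Bg → C.Dom → ℝ} {j : ℕ}
    (hsub : ∀ c : ℝ, r j (restrictScale j (H - c • A)) = r j (restrictScale j H) - r j (restrictScale j (c • A)))
    (hcoef : ∀ c : ℝ, r j (restrictScale j (c • A)) = c * r j (restrictScale j A))
    (hnorm : r j (restrictScale j A) = 1 ∨ r j (restrictScale j H) = 0) :
    r j (restrictScale j (margProj r A H)) = 0 := by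
  rw [read_restrictScale_margProj_eq hsub hcoef]
  rcases hnorm with h | h
  · rw [h, sub_self, mul_zero]
  · rw [h, zero_mul]

/-- **THE NORMALISATION IS LOAD-BEARING**: if `r_j(A↾j) ≠ 1` and the family has a non-zero scale-j read-out, the projected
slice is NOT read-out-free. [folklore] -/
theorem read_restrictScale_margProj_ne_zero {r : ℕ → (Bg → C.Dom → ℝ) → ℝ} {A H : Bg → C.Dom → ℝ} {j : ℕ}
    (hsub : ∀ c : ℝ, r j (restrictScale j (H - c • A)) = r j (restrictScale j H) - r j (restrictScale j (c • A)))
    (hcoef : ∀ c : ℝ, r j (restrictScale j (c • A)) = c * r j (restrictScale j A))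
    (hA : r j (restrictScale j A) ≠ 1) (hH : r j (restrictScale j H) ≠ 0) :
    r j (restrictScale j (margProj r A H)) ≠ 0 := by
  rw [read_restrictScale_margProj_eq hsub hcoef]
  exact mul_ne_zero hH (sub_ne_zero.mpr (Ne.symm hA))

/-! ## §2 The binder `ProjInto` for the read-out projection -/

/-- **LEAF MP (abstract read-out level).**  The read-out projection maps the admissible class into the marginal-free class
«structural class `S` ∩ ker r» as soon as: the projections lie in `S`; `r_j` is additive on the pairs `(H, c·A)`, `H ∈ Adm`;
`r_j` is homogeneous on the ray `ℝ·A`; and, scale by scale, `r_j` is NORMALISED against `A` or vanishes on `Adm` (scale 0: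
nothing is read there, (0.23) p. 256).  The conclusion is LITERALLY the binder `hPinto` of
`NE9MarginalProjectionEnd.ne9_and_fadingMemory_of_couplingTwoPoint_vacSub_sizeInduction_margProj` at this `MF`.
[cite: Balaban1987RG1, (0.23) p.256, (0.28) p.258 and (1.20)-(1.22) p.264] -/
theorem projInto_margProj {Adm S : Set (Bg → C.Dom → ℝ)} {r : ℕ → (Bg → C.Dom → ℝ) → ℝ} {A : Bg → C.Dom → ℝ}
    (hS : ∀ H ∈ Adm, margProj r A H ∈ S)
    (hsub : ∀ j, ∀ H ∈ Adm, ∀ c : ℝ,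
      r j (restrictScale j (H - c • A)) = r j (restrictScale j H) - r j (restrictScale j (c • A)))
    (hcoef : ∀ (j : ℕ) (c : ℝ), r j (restrictScale j (c • A)) = c * r j (restrictScale j A))
    (hnorm : ∀ j : ℕ, r j (restrictScale j A) = 1 ∨ ∀ H ∈ Adm, r j (restrictScale j H) = 0) :
    ProjInto Adm {H | H ∈ S ∧ ∀ j, r j (restrictScale j H) = 0} (margProj r A) := by
  intro H hH
  refine ⟨hS H hH, fun j => ?_⟩
  exact read_restrictScale_margProj_eq_zero (hsub j H hH) (hcoef j) ((hnorm j).imp_right fun h => h H hH)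

/-- The same from the frame's own additivity binder `ReadAdditive Adm r` when the marginal ray lies in the admissible class
(`c·A ∈ Adm` for every `c` — for Bałaban's class of analytic bounded families and `A` the one-cube Wilson action: with O1).
[cite: Balaban1987RG1, (1.17)-(1.18) p.263 and (1.20)-(1.22) p.264] -/
theorem projInto_margProj_of_readAdditive {Adm S : Set (Bg → C.Dom → ℝ)} {r : ℕ → (Bg → C.Dom → ℝ) → ℝ}
    {A : Bg → C.Dom → ℝ} (hS : ∀ H ∈ Adm, margProj r A H ∈ S) (hadd : ReadAdditive Adm r) (hray : ∀ c : ℝ, c • A ∈ Adm)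
    (hcoef : ∀ (j : ℕ) (c : ℝ), r j (restrictScale j (c • A)) = c * r j (restrictScale j A))
    (hnorm : ∀ j : ℕ, r j (restrictScale j A) = 1 ∨ ∀ H ∈ Adm, r j (restrictScale j H) = 0) :
    ProjInto Adm {H | H ∈ S ∧ ∀ j, r j (restrictScale j H) = 0} (margProj r A) :=
  projInto_margProj hS (fun j H hH c => hadd j H hH (c • A) (hray c)) hcoef hnorm

/-- **LEAF MP FOR THE SHIFTED READ-OUT** `shiftRead r₀` (`r (k+1) := r₀ k` reads the scale-(k+1) slice, `r 0 := 0`): the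
three identities are needed AT THE READ STEPS only — additivity on the pairs, homogeneity on the ray, normalisation
`r₀ k (A↾(k+1)) = 1`. [cite: Balaban1987RG1, (0.23) p.256 and (1.20)-(1.22) p.264] -/
theorem projInto_margProj_shiftRead {Adm S : Set (Bg → C.Dom → ℝ)} {r₀ : ReadOut C Bg} {A : Bg → C.Dom → ℝ}
    (hS : ∀ H ∈ Adm, margProj (shiftRead r₀) A H ∈ S)
    (hsub : ∀ k, ∀ H ∈ Adm, ∀ c : ℝ, r₀ k (restrictScale (k + 1) (H - c • A)) =
      r₀ k (restrictScale (k + 1) H) - r₀ k (restrictScale (k + 1) (c • A)))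
    (hcoef : ∀ (k : ℕ) (c : ℝ), r₀ k (restrictScale (k + 1) (c • A)) = c * r₀ k (restrictScale (k + 1) A))
    (hnorm : ∀ k : ℕ, r₀ k (restrictScale (k + 1) A) = 1) :
    ProjInto Adm {H | H ∈ S ∧ ∀ j, shiftRead r₀ j (restrictScale j H) = 0} (margProj (shiftRead r₀) A) := by
  refine projInto_margProj hS (fun j H hH c => ?_) (fun j c => ?_) (fun j => ?_)
  · rcases j with _ | k
    · simp [shiftRead]
    · simpa [shiftRead] using hsub k H hH c
  · rcases j with _ | k
    · simp [shiftRead]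
    · simpa [shiftRead] using hcoef k c
  · rcases j with _ | k
    · exact Or.inr fun H _ => by simp [shiftRead]
    · exact Or.inl (by simpa [shiftRead] using hnorm k)

/-- DICTIONARY SANITY (i): on a marginal-free family the projection is the identity — `𝒯 ∘ P` agrees with `𝒯` on the class
where the size binder S5-MF is displayed. [folklore] -/
theorem margProj_eq_self_of_read_eq_zero {r : ℕ → (Bg → C.Dom → ℝ) → ℝ} (A : Bg → C.Dom → ℝ) {H : Bg → C.Dom → ℝ}
    (h : ∀ j, r j (restrictScale j H) = 0) : margProj r A H = H := by
  funext U X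
  simp only [margProj, h, zero_mul, sub_zero]

/-- DICTIONARY SANITY (ii): the projection is IDEMPOTENT under the §1 hypotheses (P ∘ P = P — it is a projection).
[folklore] -/
theorem margProj_idem {r : ℕ → (Bg → C.Dom → ℝ) → ℝ} {A H : Bg → C.Dom → ℝ}
    (hsub : ∀ j, ∀ c : ℝ, r j (restrictScale j (H - c • A)) = r j (restrictScale j H) - r j (restrictScale j (c • A)))
    (hcoef : ∀ (j : ℕ) (c : ℝ), r j (restrictScale j (c • A)) = c * r j (restrictScale j A))
    (hnorm : ∀ j : ℕ, r j (restrictScale j A) = 1 ∨ r j (restrictScale j H) = 0) :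
    margProj r A (margProj r A H) = margProj r A H :=
  margProj_eq_self_of_read_eq_zero A fun j => read_restrictScale_margProj_eq_zero (hsub j) (hcoef j) (hnorm j)

/-! ## §3 Probe recipes: homogeneity is kernel, so MP ⇐ the normalisation number alone -/

section ProbeRecipes

variable {V : Type*} [NormedAddCommGroup V] [NormedSpace ℂ V] {ιp : Type*}

/-- The rebuilt chart function of `c·F` is `c` times the chart function of `F`. [folklore] -/
theorem cplx_smul (Pr : Probes C Bg V ιp) (c : ℝ) (F : Slice C Bg) (k : ℕ) (p : ιp) :
    Pr.cplx (c • F) k p = fun v => (c : ℂ) * Pr.cplx F k p v := by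
  funext v
  simp only [Probes.cplx, Pi.smul_apply, smul_eq_mul]
  push_cast
  ring

/-- The (4.3) mixed derivative of a constant multiple of an analytic chart function ((1.20) is linear in the term family).
[cite: Balaban1987RG1, (1.20) p.264 and (4.3)-(4.4) p.281] -/
theorem mixedDeriv_const_mul {f : V → ℂ} {α : ℝ} (hα : 0 < α) (hf : AnalyticOnNhd ℂ f (ball 0 α)) (c : ℂ) (a b : V) :
    mixedDeriv (fun v => c * f v) a b = c * mixedDeriv f a b := by
  unfold mixedDeriv
  have h0 : (0 : ℂ) • b ∈ ball (0 : V) α := by simpa using hα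
  have hnear : ∀ᶠ τ : ℂ in nhds 0, τ • b ∈ ball (0 : V) α :=
    (continuous_id.smul continuous_const).continuousAt.eventually_mem (isOpen_ball.mem_nhds h0)
  have hev : (fun τ : ℂ => (fderiv ℂ (fun v => c * f v) (τ • b)) a) =ᶠ[nhds 0]
      fun τ : ℂ => c * (fderiv ℂ f (τ • b)) a := by
    filter_upwards [hnear] with τ hτ
    rw [fderiv_const_mul (hf _ hτ).differentiableAt c]
    rfl
  rw [hev.deriv_eq, deriv_const_mul_field]

/-- **A PROBE RECIPE IS HOMOGENEOUS on slices with analytic charts** (companion of `NE4ReadOutSocketMarginalRecipe.recipe_sub`;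
(1.20)–(1.22) is linear in the term family). [cite: Balaban1987RG1, (1.20)-(1.22) p.264 and (4.3)-(4.4) p.281] -/
theorem recipe_smul (Pr : Probes C Bg V ιp) {α : ℝ} (hα : 0 < α) {F : Slice C Bg} (hF : F ∈ Pr.Analytic α) (c : ℝ)
    (k : ℕ) : Pr.recipe k (c • F) = c * Pr.recipe k F := by
  simp only [Probes.recipe]
  rw [Finset.mul_sum]
  refine Finset.sum_congr rfl fun p hp => ?_
  rw [cplx_smul, mixedDeriv_const_mul hα (hF k p hp), Complex.re_ofReal_mul]
  ring

/-- Constant multiples stay in the analytic class. [folklore] -/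
theorem smul_mem_analytic (Pr : Probes C Bg V ιp) {α : ℝ} {F : Slice C Bg} (hF : F ∈ Pr.Analytic α) (c : ℝ) :
    c • F ∈ Pr.Analytic α := by
  intro k p hp
  rw [cplx_smul]
  exact analyticOnNhd_const.mul (hF k p hp)

/-- Differences stay in the analytic class. [folklore] -/
theorem sub_mem_analytic (Pr : Probes C Bg V ιp) {α : ℝ} {F G : Slice C Bg} (hF : F ∈ Pr.Analytic α)
    (hG : G ∈ Pr.Analytic α) : F - G ∈ Pr.Analytic α := by
  intro k p hp
  rw [cplx_sub]
  exact (hF k p hp).sub (hG k p hp)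

/-- **The projection of an analytic slice along an analytic direction is analytic, for ANY read-out** (on the probes'
scale-(k+1) domains the projected family is `H − c_{k+1}·A` with a CONSTANT coefficient).
[cite: Balaban1987RG1, (1.3) p.260 and (1.17) p.263] -/
theorem margProj_mem_analytic (Pr : Probes C Bg V ιp) {α : ℝ} (r : ℕ → Slice C Bg → ℝ) {A H : Slice C Bg}
    (hH : H ∈ Pr.Analytic α) (hA : A ∈ Pr.Analytic α) : margProj r A H ∈ Pr.Analytic α := by
  intro k p hp
  have hchart : Pr.cplx (margProj r A H) k p =
      fun v => Pr.cplx H k p v - (r (k + 1) (restrictScale (k + 1) H) : ℂ) * Pr.cplx A k p v := by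
    funext v
    simp only [Probes.cplx, margProj, Pr.scale_dom k p hp]
    push_cast
    ring
  rw [hchart]
  exact (hH k p hp).sub (analyticOnNhd_const.mul (hA k p hp))

/-- **LEAF MP FOR PROBE RECIPES (kernel modulo ONE normalisation number per read step).**  For node U2's probe recipe
`Pr.recipe` (chart radius `α > 0`), an admissible class of analytic slices, an analytic marginal direction `A` READ AS 1
by every step's recipe (`hnorm` — [I] p. 258 «the coefficient β» of βA^η, (1.20)–(1.22) p. 264: TYPE, displayed), and a
structural class `S` containing the projections (displayed): the read-out projection `margProj (shiftRead Pr.recipe) A` maps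
`Adm` into the marginal-free class «analytic ∩ S ∩ {every step's recipe reads 0}».  Together with
`NE4ReadOutSocketMarginalRecipe.projBinders_recipe` all four projection binders of the marginal-projection END faces are
kernel for probe recipes modulo `hnorm` and `hS`. [cite: Balaban1987RG1, (0.28) p.258, (1.17) p.263 and (1.20)-(1.22) p.264] -/
theorem projInto_recipe (Pr : Probes C Bg V ιp) {α : ℝ} (hα : 0 < α) {Adm S : Set (Slice C Bg)} {A : Slice C Bg}
    (hAn : Adm ⊆ Pr.Analytic α) (hA : A ∈ Pr.Analytic α) (hS : ∀ H ∈ Adm, margProj (shiftRead Pr.recipe) A H ∈ S)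
    (hnorm : ∀ k, Pr.recipe k A = 1) :
    ProjInto Adm {H | H ∈ Pr.Analytic α ∧ H ∈ S ∧ ∀ k, Pr.recipe k H = 0} (margProj (shiftRead Pr.recipe) A) := by
  intro H hH
  refine ⟨margProj_mem_analytic Pr _ (hAn hH) hA, hS H hH, fun k => ?_⟩
  have hsub : ∀ c : ℝ, shiftRead Pr.recipe (k + 1) (restrictScale (k + 1) (H - c • A)) =
      shiftRead Pr.recipe (k + 1) (restrictScale (k + 1) H) - shiftRead Pr.recipe (k + 1) (restrictScale (k + 1) (c • A)) := by
    intro c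
    simp only [shiftRead, Nat.succ_ne_zero, if_false, Nat.succ_sub_one, recipe_restrictScale]
    exact recipe_sub Pr hα (hAn hH) (smul_mem_analytic Pr hA c) k
  have hcoef : ∀ c : ℝ, shiftRead Pr.recipe (k + 1) (restrictScale (k + 1) (c • A)) =
      c * shiftRead Pr.recipe (k + 1) (restrictScale (k + 1) A) := by
    intro c
    simp only [shiftRead, Nat.succ_ne_zero, if_false, Nat.succ_sub_one, recipe_restrictScale]
    exact recipe_smul Pr hα hA c k
  have hone : shiftRead Pr.recipe (k + 1) (restrictScale (k + 1) A) = 1 := by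
    simp only [shiftRead, Nat.succ_ne_zero, if_false, Nat.succ_sub_one, recipe_restrictScale, hnorm k]
  have h := read_restrictScale_margProj_eq_zero (H := H) hsub hcoef (Or.inl hone)
  simpa only [shiftRead, Nat.succ_ne_zero, if_false, Nat.succ_sub_one, recipe_restrictScale] using h

/-- Unfolded reading of the normalisation binder: `Pr.recipe k A = 1` is the same number as `Pr.recipe k (A↾(k+1)) = 1` (the
probes of step k sit on the scale-(k+1) slice). [cite: Balaban1987RG1, (1.20)-(1.22) p.264] -/
theorem recipe_normalised_iff (Pr : Probes C Bg V ιp) (A : Slice C Bg) (k : ℕ) :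
    Pr.recipe k (restrictScale (k + 1) A) = 1 ↔ Pr.recipe k A = 1 := by
  rw [recipe_restrictScale]

end ProbeRecipes

/-! ## §4 Sanity: the owner's toy `toy_projInto` re-derived from §2 -/

open NE9MarginalProjectionEnd (toyC toyMF toyRead toyDir) in
/-- The toy read-out projection of `NE9MarginalProjectionEnd` lands in the toy marginal-free class — now as an INSTANCE of
`projInto_margProj` (S := everything; additivity, homogeneity and normalisation of `toyRead` against `toyDir` by `simp`).
[folklore] -/
example : ProjInto (C := toyC) Set.univ toyMF (margProj toyRead toyDir) := by
  have h := projInto_margProj (C := toyC) (Adm := Set.univ) (S := Set.univ) (r := toyRead) (A := toyDir)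
    (fun _ _ => Set.mem_univ _)
    (fun j H _ c => by simp [toyRead, toyDir, restrictScale])
    (fun j c => by simp [toyRead, toyDir, restrictScale])
    (fun j => Or.inl (by simp [toyRead, toyDir, restrictScale]))
  intro H hH
  obtain ⟨-, hzero⟩ := h H hH
  intro j
  simpa [toyRead, restrictScale] using hzero j

end Summit.QuantumFields.BalabanUV.T4Continuum.NE9MarginalFreeClass

end
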